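import Mathlib.Algebra.MvPolynomial.CommRing
import Mathlib.Algebra.Polynomial.Basic
import Mathlib.Analysis.Complex.Basic
import Mathlib.Data.Matrix.Basic
import Mathlib.LinearAlgebra.Matrix.Notation
import Mathlib.Tactic
import Literature.Computability.AlgebraicComplexity.QuasiPolynomialFormulasProofs
import HarnessLib

/-!
# Integral border Q-words (Bringmann–Ikenmeyer–Zuiddam 2018, §3): the closure calculus

Bringmann, Ikenmeyer and Zuiddam prove `VF ⊆ closure(VP₂)` (J. ACM 65 (2018) art. 32, Thm 3.1)
by writing, for every polynomial `f` with a small formula, some matrix `F ∈ Q(f) + O(ε)` as a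
short product of *primitive Q-matrices* `Q(a) = [[a, 1], [1, 0]]`, `a` a constant of `ℂ(ε)` or a
variable (Lemmas 3.2–3.4, Prop. 3.5).  This file sets up their calculus in an INTEGRAL form
suited to the tree (no field of Laurent series, no topology): clearing the denominators of the
constants, a *letter* is `((c, o), m) : (ℂ[ε] × Option σ) × ℕ`, read as the matrix
`[[C c · (1 | x_v), ε^m], [ε^m, 0]]` over `ℂ[ε][x_σ]` (`= ε^m · Q(c ε^{-m})` for `o = none`, and
`Q(x_v)` for `((1, some v), 0)`), and

  `IBQ[σ | f, μ, κ, L]` : some word of at most `L` letters has product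
  `ε^M · Q(f) + ε^(M+κ) · G` with `M ≤ μ` ("shift `≤ μ`, precision `κ`") and `G` integral,

written as a LOCAL NOTATION for a spelled-out existential (deliberately not a definition: the
crux skeleton `Summits/ValiantsHypothesis/ValiantsHypothesis/Cruxes/WordLengthQP/Lines/Sketch.lean`
and its landed stubs state everything in this spelled-out form, and so does this file, so that
the statements match syntactically).

The four GADGETS — addition `P_F · Q(0) · P_G` (BIZ18 Lemma 3.2), free scalars by diagonal
conjugation, the substitution `ε ↦ ε³` (proof of Prop. 3.5) and squaring (Lemma 3.3) — are taken
here as HYPOTHESES `ADD[σ]`, `SMUL[σ]`, `CUBE[σ]`, `SQ[σ]` at the ambient variable type (they are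
proved, in exactly this form, in
`Summits/ValiantsHypothesis/ValiantsHypothesis/Theorems/ElementaryWordLengthWordLengthQPStubIbq{Add,Smul,Cube,Square}.lean`,
which a `Literature` file cannot import).  From them this file derives:

* `BorderQWord.ibq_X`, `ibq_C`, `ibq_mono`, `ibq_prec` — one-letter words, monotonicity, precision;
* `BorderQWord.ibq_mul3` — BIZ18 Lemma 3.4 (multiplication through `fg = -(f/2)² - g² + (f/2+g)²`,
  `polarisation_half`) followed by `ε ↦ ε³`, so that products stay at precision `3`:
  `(μ₁, L₁), (μ₂, L₂) ↦ (12 (μ₁ + μ₂ + 3), 4 (L₁ + L₂) + 73)`;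
* `BorderQWord.ibq_list_prod` — `n` factors with bounds `(m, b)` ↦ `(25ⁿ (m + 3), 9ⁿ (b + 20))`;
* `BorderQWord.ibq_list_sum`, `ibq_finset_sum` — sums: shifts add, lengths add plus joints;
* `BorderQWord.ibq_of_totalDegree_le_one` — affine forms in `n` variables: exact words of
  `≤ 8 n + 9` letters (BIZ18 Prop. 3.5, case `d = 0`, with free scalars).

## Design notes

* Everything is over `ℂ` (the free-scalar gadget uses square roots) and a variable type
  `σ : Type`; constants of bounds are explicit and not optimised.
* Hypotheses of this size must stand AFTER the colon: as named binders before the colon the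
  statement alone exhausts the default heartbeat budget of the elaborator (observed 2026-08-16).
* Companion file `BorderQWordStages.lean` runs these rules along the VSBR stage recursion of
  `GateQuotients.lean` (BIZ18 Thm 3.1 at quasi-polynomial scale, from circuits).

## References

* K. Bringmann, C. Ikenmeyer, J. Zuiddam, *On algebraic branching programs of small width*,
  J. ACM 65 (2018) art. 32 (CCC 2017; arXiv:1702.05328), §3: Lemmas 3.2–3.4, Prop. 3.5, Thm 3.1
  [BringmannIkenmeyerZuiddam2018].
* M. Ben-Or, R. Cleve, *Computing algebraic formulas using a constant number of registers*,
  SIAM J. Comput. 21 (1992) (the three-register simulation BIZ adapt to width two).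
-/

noncomputable section

open MvPolynomial

namespace Literature.Computability.AlgebraicComplexity

namespace BorderQWord

/-- `IBQ[σ | f, μ, κ, L]` (local notation, not a definition): `f` has an integral border Q-word of
shift `≤ μ`, precision `κ`, length `≤ L` — spelled out exactly as in the skeleton of the line. -/
local notation3 (prettyPrint := false) "IBQ[" σ " | " f ", " μ ", " κ ", " L "]" =>
  ∃ w : List ((Polynomial ℂ × Option σ) × ℕ), w.length ≤ L ∧ ∃ M : ℕ, M ≤ μ ∧
    ∃ G : Matrix (Fin 2) (Fin 2) (MvPolynomial σ (Polynomial ℂ)),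
      (w.map (fun l => (!![MvPolynomial.C l.1.1 * l.1.2.elim 1 MvPolynomial.X,
          MvPolynomial.C (Polynomial.X ^ l.2); MvPolynomial.C (Polynomial.X ^ l.2), 0] :
            Matrix (Fin 2) (Fin 2) (MvPolynomial σ (Polynomial ℂ))))).prod
        = (MvPolynomial.C (Polynomial.X ^ M) : MvPolynomial σ (Polynomial ℂ)) •
            (!![MvPolynomial.map Polynomial.C f, 1; 1, 0] :
              Matrix (Fin 2) (Fin 2) (MvPolynomial σ (Polynomial ℂ)))
          + (MvPolynomial.C (Polynomial.X ^ (M + κ)) : MvPolynomial σ (Polynomial ℂ)) • G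

/-- `ADD[σ]` (local notation): the addition gadget at the variable type `σ` (BIZ18 Lemma 3.2). -/
local notation3 (prettyPrint := false) "ADD[" σ "]" =>
  ∀ (f g : MvPolynomial σ ℂ) (μ₁ μ₂ κ L₁ L₂ : ℕ),
    IBQ[σ | f, μ₁, κ, L₁] → IBQ[σ | g, μ₂, κ, L₂] → IBQ[σ | f + g, μ₁ + μ₂, κ, L₁ + L₂ + 1]

/-- `SMUL[σ]` (local notation): the free-scalar gadget at the variable type `σ`. -/
local notation3 (prettyPrint := false) "SMUL[" σ "]" =>
  ∀ (γ : ℂ) (f : MvPolynomial σ ℂ) (μ κ L : ℕ), IBQ[σ | f, μ, κ, L] → IBQ[σ | γ • f, μ, κ, L + 6]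

/-- `CUBE[σ]` (local notation): the substitution `ε ↦ ε³` at the variable type `σ`. -/
local notation3 (prettyPrint := false) "CUBE[" σ "]" =>
  ∀ (f : MvPolynomial σ ℂ) (μ κ L : ℕ), IBQ[σ | f, μ, κ, L] → IBQ[σ | f, 3 * μ, 3 * κ, L]

/-- `SQ[σ]` (local notation): the squaring gadget at the variable type `σ` (BIZ18 Lemma 3.3). -/
local notation3 (prettyPrint := false) "SQ[" σ "]" =>
  ∀ (f : MvPolynomial σ ℂ) (μ L : ℕ), IBQ[σ | f, μ, 3, L] → IBQ[σ | f ^ 2, 2 * μ + 4, 1, 2 * L + 11]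

variable {σ : Type}

/-! ### One-letter words, monotonicity, precision -/

/-- The variable `x_v` is the one-letter exact word `Q(x_v)`. [cite: BringmannIkenmeyerZuiddam2018, §3 (primitive Q-matrices)] -/
theorem ibq_X (v : σ) (κ : ℕ) : IBQ[σ | (X v : MvPolynomial σ ℂ), 0, κ, 1] := by
  refine ⟨[((1, some v), 0)], le_rfl, 0, le_rfl, 0, ?_⟩
  simp

/-- The constant `c` is the one-letter exact word `Q(c)`. [cite: BringmannIkenmeyerZuiddam2018, §3 (primitive Q-matrices)] -/
theorem ibq_C (c : ℂ) (κ : ℕ) : IBQ[σ | (C c : MvPolynomial σ ℂ), 0, κ, 1] := by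
  refine ⟨[((Polynomial.C c, none), 0)], le_rfl, 0, le_rfl, 0, ?_⟩
  simp [MvPolynomial.map_C]

/-- Monotonicity in the shift and length bounds. [folklore] -/
theorem ibq_mono {f : MvPolynomial σ ℂ} {μ μ' κ L L' : ℕ} (h : IBQ[σ | f, μ, κ, L]) (hμ : μ ≤ μ')
    (hL : L ≤ L') : IBQ[σ | f, μ', κ, L'] := by
  obtain ⟨w, hw, M, hM, G, hG⟩ := h
  exact ⟨w, hw.trans hL, M, hM.trans hμ, G, hG⟩

/-- Lowering the precision: `ε^(M+κ'+t) G = ε^(M+κ') (ε^t G)`. [folklore] -/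
theorem ibq_prec {f : MvPolynomial σ ℂ} {μ κ κ' L : ℕ} (h : IBQ[σ | f, μ, κ, L]) (hκ : κ' ≤ κ) :
    IBQ[σ | f, μ, κ', L] := by
  obtain ⟨w, hw, M, hM, G, hG⟩ := h
  obtain ⟨t, rfl⟩ := Nat.exists_eq_add_of_le hκ
  refine ⟨w, hw, M, hM, (MvPolynomial.C (Polynomial.X ^ t) :
    MvPolynomial σ (Polynomial ℂ)) • G, ?_⟩
  rw [hG, smul_smul, ← map_mul, ← pow_add, ← add_assoc]

/-! ### The multiplication gadget (BIZ18 Lemma 3.4) at precision `3` -/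

/-- The polarisation identity behind BIZ18 Lemma 3.4: `-(f/2)² - g² + (f/2 + g)² = f g`. [cite: BringmannIkenmeyerZuiddam2018, Lemma 3.4 (proof)] -/
theorem polarisation_half (f g : MvPolynomial σ ℂ) :
    (-1 : ℂ) • ((2⁻¹ : ℂ) • f) ^ 2 + (-1 : ℂ) • g ^ 2 + ((2⁻¹ : ℂ) • f + g) ^ 2 = f * g := by
  have h2 : (C (2⁻¹ : ℂ) : MvPolynomial σ ℂ) * 2 = 1 := by
    rw [show (2 : MvPolynomial σ ℂ) = C 2 from (map_ofNat C 2).symm, ← map_mul]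
    norm_num
  simp only [MvPolynomial.smul_eq_C_mul, map_neg, map_one]
  linear_combination (f * g) * h2

/-- **Multiplication** (BIZ18 Lemma 3.4, then `ε ↦ ε³`): from words for `f` and `g` at precision
`3`, a word for `f g` at precision `3`, via `f g = -(f/2)² - g² + (f/2 + g)²`; shift
`12 (μ₁ + μ₂ + 3)`, length `4 (L₁ + L₂) + 73`. [cite: BringmannIkenmeyerZuiddam2018, Lemma 3.4] -/
theorem ibq_mul3 : ADD[σ] → SMUL[σ] → CUBE[σ] → SQ[σ] →
    ∀ {f g : MvPolynomial σ ℂ} {μ₁ μ₂ L₁ L₂ : ℕ},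
      IBQ[σ | f, μ₁, 3, L₁] → IBQ[σ | g, μ₂, 3, L₂] →
      IBQ[σ | f * g, 12 * (μ₁ + μ₂ + 3), 3, 4 * (L₁ + L₂) + 73] := by
  intro hadd hsmul hcube hsq f g μ₁ μ₂ L₁ L₂ hf hg
  have h1 : IBQ[σ | (2⁻¹ : ℂ) • f, μ₁, 3, L₁ + 6] := hsmul _ f _ _ _ hf
  have h2 : IBQ[σ | ((2⁻¹ : ℂ) • f) ^ 2, 2 * μ₁ + 4, 1, 2 * (L₁ + 6) + 11] := hsq _ _ _ h1
  have h3 : IBQ[σ | (-1 : ℂ) • ((2⁻¹ : ℂ) • f) ^ 2, 2 * μ₁ + 4, 1, 2 * (L₁ + 6) + 11 + 6] :=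
    hsmul _ _ _ _ _ h2
  have h4 : IBQ[σ | g ^ 2, 2 * μ₂ + 4, 1, 2 * L₂ + 11] := hsq _ _ _ hg
  have h5 : IBQ[σ | (-1 : ℂ) • g ^ 2, 2 * μ₂ + 4, 1, 2 * L₂ + 11 + 6] := hsmul _ _ _ _ _ h4
  have h6 : IBQ[σ | (2⁻¹ : ℂ) • f + g, μ₁ + μ₂, 3, L₁ + 6 + L₂ + 1] := hadd _ _ _ _ _ _ _ h1 hg
  have h7 : IBQ[σ | ((2⁻¹ : ℂ) • f + g) ^ 2, 2 * (μ₁ + μ₂) + 4, 1, 2 * (L₁ + 6 + L₂ + 1) + 11] :=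
    hsq _ _ _ h6
  have h8 := hadd _ _ _ _ _ _ _ h3 h5
  have h9 := hadd _ _ _ _ _ _ _ h8 h7
  have h10 := hcube _ _ _ _ h9
  rw [polarisation_half] at h10
  have h11 : IBQ[σ | f * g, 3 * (2 * μ₁ + 4 + (2 * μ₂ + 4) + (2 * (μ₁ + μ₂) + 4)), 3,
      2 * (L₁ + 6) + 11 + 6 + (2 * L₂ + 11 + 6) + 1 + (2 * (L₁ + 6 + L₂ + 1) + 11) + 1] :=
    ibq_prec h10 le_rfl
  exact ibq_mono h11 (by omega) (by omega)

/-- **Products of lists** at precision `3`: `n` factors with bounds `(m, b)` give a word with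
bounds `(25ⁿ (m + 3), 9ⁿ (b + 20))` (iterated `ibq_mul3` from the empty product `1 = Q(1)`). [cite: BringmannIkenmeyerZuiddam2018, Prop. 3.5 (proof)] -/
theorem ibq_list_prod : ADD[σ] → SMUL[σ] → CUBE[σ] → SQ[σ] →
    ∀ {T : List (MvPolynomial σ ℂ)} {m b : ℕ}, (∀ p ∈ T, IBQ[σ | p, m, 3, b]) →
      IBQ[σ | T.prod, 25 ^ T.length * (m + 3), 3, 9 ^ T.length * (b + 20)] := by
  intro hadd hsmul hcube hsq T
  induction T with
  | nil =>
    intro m b _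
    refine ibq_mono ?_ (Nat.zero_le _) (show 1 ≤ 9 ^ 0 * (b + 20) by omega)
    simpa using ibq_C (σ := σ) (1 : ℂ) 3
  | cons p T ih =>
    intro m b h
    have hp := h p (by simp)
    have hT := ih fun q hq => h q (by simp [hq])
    have := ibq_mul3 hadd hsmul hcube hsq hp hT
    rw [List.prod_cons, List.length_cons]
    refine ibq_mono this ?_ ?_
    · have h25 : 1 ≤ 25 ^ T.length := Nat.one_le_pow _ _ (by norm_num)
      rw [pow_succ]
      nlinarith
    · have h9 : 1 ≤ 9 ^ T.length := Nat.one_le_pow _ _ (by norm_num)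
      rw [pow_succ]
      nlinarith

/-! ### Sums -/

/-- **Sums of lists** (iterated addition from the empty sum `0 = Q(0)`): shifts add, lengths add
plus one joint letter per summand. [cite: BringmannIkenmeyerZuiddam2018, Lemma 3.2 and Prop. 3.5 (proof)] -/
theorem ibq_list_sum : ADD[σ] →
    ∀ {Ls : List (MvPolynomial σ ℂ)} {m κ b : ℕ}, (∀ p ∈ Ls, IBQ[σ | p, m, κ, b]) →
      IBQ[σ | Ls.sum, Ls.length * m, κ, Ls.length * (b + 1) + 1] := by
  intro hadd Ls
  induction Ls with
  | nil =>
    intro m κ b _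
    simpa using ibq_C (σ := σ) (0 : ℂ) κ
  | cons p Ls ih =>
    intro m κ b h
    have hp := h p (by simp)
    have hL := ih fun q hq => h q (by simp [hq])
    have := hadd _ _ _ _ _ _ _ hp hL
    rw [List.sum_cons, List.length_cons]
    refine ibq_mono this ?_ ?_
    · rw [Nat.succ_mul]; omega
    · rw [Nat.succ_mul]; omega

/-- **Sums over a `Finset`**: `#s` summands with bounds `(m, b)` give `(#s · m, #s (b+1) + 1)`. [cite: BringmannIkenmeyerZuiddam2018, Lemma 3.2 and Prop. 3.5 (proof)] -/
theorem ibq_finset_sum {α : Type*} : ADD[σ] →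
    ∀ (s : Finset α) {q : α → MvPolynomial σ ℂ} {m κ b : ℕ}, (∀ a ∈ s, IBQ[σ | q a, m, κ, b]) →
      IBQ[σ | (∑ a ∈ s, q a), s.card * m, κ, s.card * (b + 1) + 1] := by
  intro hadd s
  induction s using Finset.cons_induction with
  | empty =>
    intro q m κ b _
    simpa using ibq_C (σ := σ) (0 : ℂ) κ
  | cons a s ha ih =>
    intro q m κ b h
    have hp := h a (by simp)
    have hs := ih fun x hx => h x (by simp [hx])
    have := hadd _ _ _ _ _ _ _ hp hs
    rw [Finset.sum_cons, Finset.card_cons]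
    refine ibq_mono this ?_ ?_
    · rw [Nat.succ_mul]; omega
    · rw [Nat.succ_mul]; omega

/-! ### Affine forms (stage 0) -/

/-- A monomial of degree `≤ 1` (`C c` or `C c * X i = c • X i`) has an exact word of `≤ 7`
letters. [cite: BringmannIkenmeyerZuiddam2018, Prop. 3.5 (case d = 0)] -/
theorem ibq_monomial_of_degree_le_one : SMUL[σ] →
    ∀ (n : σ →₀ ℕ) (c : ℂ) (κ : ℕ), (n.sum fun _ e => e) ≤ 1 →
      IBQ[σ | (monomial n c : MvPolynomial σ ℂ), 0, κ, 7] := by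
  intro hsmul n c κ hn
  rcases Nat.lt_or_ge (n.sum fun _ e => e) 1 with h0 | h1
  · have hn0 : n = 0 := (Finsupp.degree_eq_zero_iff n).1 (by
      change (n.sum fun _ e => e) = 0
      omega)
    subst hn0
    exact ibq_mono (ibq_C (σ := σ) c κ) le_rfl (by norm_num)
  · obtain ⟨i, rfl⟩ := (Finsupp.sum_eq_one_iff n).1 (le_antisymm hn h1)
    have h := hsmul c _ _ _ _ (ibq_X (σ := σ) i κ)
    rw [MvPolynomial.smul_eq_C_mul, C_mul_X_eq_monomial] at h
    exact h

/-- **Affine forms** (stage 0): a polynomial of total degree `≤ 1` in `n = #σ` variables is the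
sum of its `≤ n + 1` monomials, hence has an exact word of `≤ 8 n + 9` letters. [cite: BringmannIkenmeyerZuiddam2018, Prop. 3.5 (case d = 0) with Prop. 5.10] -/
theorem ibq_of_totalDegree_le_one [Fintype σ] : ADD[σ] → SMUL[σ] →
    ∀ {p : MvPolynomial σ ℂ}, p.totalDegree ≤ 1 → ∀ κ : ℕ,
      IBQ[σ | p, 0, κ, 8 * Fintype.card σ + 9] := by
  intro hadd hsmul p hp κ
  have hmon : ∀ n ∈ p.support, IBQ[σ | (monomial n (coeff n p) : MvPolynomial σ ℂ), 0, κ, 7] :=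
    fun n hn => ibq_monomial_of_degree_le_one hsmul n _ κ ((le_totalDegree hn).trans hp)
  have h := ibq_finset_sum hadd p.support hmon
  rw [← p.as_sum] at h
  have hc := ArithCircuit.card_support_le_of_totalDegree_le_one hp
  refine ibq_mono h (by simp) ?_
  nlinarith

end BorderQWord

end Literature.Computability.AlgebraicComplexity
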